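/-
line stmt-HodgeConjecture-18881 Cruxes/BlochSeedDiscOne/Lines/birth.lean 814a6a70c14e831a stub_rung_pad4_seedAt

# UnipotentEInfSum — THEOREM E∞ kernel-checked FROM THE BLOCK FORM ON (hsemireg-alphabet-unipotent-1, generation 15, companion of `UnipotentEInfLaw.lean`)

EVIDENCE ONLY. Nothing in this file is a rung, and nothing here is proved toward HC / HC_CM / HC_AV / №4 / 26512 / 18881 / H2.
`UnipotentEInfLaw.lean` checks the scalar inequalities of memo §3 with the level sums abstracted into variables; THIS file removes that
abstraction: the block profile of K = ker z and the conjugate drop partition are honest functions `b p : ℕ → ℤ`, the block form ΨA and the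
level form ΨB of memo §2 are `Finset` sums, the Abel summations (I1)–(I3) are proved (`abel_K`, `abel_D`, `blockForm_eq_levelForm`), and
`levelForm_pos` / `blockForm_pos` prove ΨB > 0 and ΨA > 0 under exactly the structural hypotheses the memo imports from g14 (listed in the
theorem statement: b antitone-at-1 and nonnegative with blocks of length ≤ m+1, p ≥ 0 vanishing beyond β, p₁ + p₂ ≤ β, 2·c_x = p_x(p_x − 1),
ℓ₂ ≥ c₁ + c₂ + Σ_{i≥2} c_{i+1}, R ≥ ν, and the i = 2 cap b₁ ≤ b₂ + p₁ + p₂ + 2).  So the ONLY pen content left in THEOREM E∞ is the list of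
module-theoretic levers of memo §1 (L7♯ e = H + r; H♭; E2; the drop/T-filtration; E1 + L6(c); L6(b) at i = 2) that produce Ψ ≥ ΨA.
Conventions: b i = number of blocks of K longer than i (b 0 = σ, ν = b 0 − b 1 = n₁); p x (x ≥ 1) = x-th conjugate part of the drop partition;
levels L = 2 … m+1 are indexed by j = L − 2 < m; K[L] = Σ_{i<L} b i, D[L] = p 1 + … + p L; τ = 1 + σ − R.  Mathlib only; no `sorry`; no options.
-/
import Mathlib

open Finset

namespace HsemiregAlphabetUnipotent1.G15Sum

/-! ## Scalar lemmas (restated from `UnipotentEInfLaw.lean` so that this file is self-contained) -/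

theorem c_nonneg (p c : ℤ) (hp : 0 ≤ p) (hc : 2 * c = p * (p - 1)) : 0 ≤ c := by
  rcases (show p = 0 ∨ 1 ≤ p by omega) with h | h
  · subst h; linarith
  · nlinarith [mul_nonneg hp (show (0:ℤ) ≤ p - 1 by linarith)]

theorem level_short (b p c : ℤ) (hb : 0 ≤ b) (hp : 0 ≤ p) (hc : 2 * c = p * (p - 1)) :
    b ^ 2 ≤ 2 * b ^ 2 + 13 * b + 15 * c - 2 * b * p := by
  by_cases h : p ≤ 1
  · have hc0 : 0 ≤ c := c_nonneg p c hp hc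
    nlinarith [mul_nonneg hb (show (0:ℤ) ≤ 1 - p by linarith)]
  · have h2 : 2 ≤ p := by
      by_contra h'; exact h (by linarith)
    nlinarith [sq_nonneg (b - p), mul_nonneg (show (0:ℤ) ≤ p - 2 by linarith) hp]

theorem level_long (b : ℤ) (hb : 0 ≤ b) : 0 ≤ 2 * b ^ 2 - b := by nlinarith

theorem q_sq_le (p₁ p₂ c : ℤ) (hc : 2 * c = p₁ * (p₁ - 1) + p₂ * (p₂ - 1)) :
    (p₁ + p₂) ^ 2 ≤ 4 * c + 2 * (p₁ + p₂) := by
  nlinarith [sq_nonneg (p₁ - p₂)]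

theorem level_one_core (σ ν β b₁ b₂ q c : ℤ) (hσ : 0 ≤ σ) (hν : 0 ≤ ν) (hβ : 0 ≤ β) (hb₁ : 0 ≤ b₁) (hb₂ : 0 ≤ b₂)
    (hc : 0 ≤ c) (hq : q ^ 2 ≤ 4 * c + 2 * q) (hcap : b₁ ≤ b₂ + q + 2) :
    0 < 9 * σ + 2 * ν + β + 2 + 13 * b₁ + 15 * c + b₂ ^ 2 - 2 * b₁ * q := by
  by_cases h6 : q ≤ 6
  · nlinarith [mul_nonneg hb₁ (show (0:ℤ) ≤ 13 - 2 * q by linarith), sq_nonneg b₂]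
  · have h7 : 7 ≤ q := by
      by_contra h'; exact h6 (by linarith)
    by_cases hbig : q + 2 ≤ b₁
    · have hsq : (b₁ - q - 2) ^ 2 ≤ b₂ ^ 2 := by nlinarith
      nlinarith [sq_nonneg (19 * q - 8 * b₁ - 7), hsq, hq]
    · have hsmall : b₁ ≤ q + 1 := by
        by_contra h'; exact hbig (by linarith)
      nlinarith [mul_nonneg (show (0:ℤ) ≤ q + 1 - b₁ by linarith) (show (0:ℤ) ≤ 2 * q - 13 by linarith), hq, sq_nonneg b₂]

/-! ## Profile sums -/

/-- K[L] = Σ_{i<L} b_i (= Σ_J min(|J|, L)). -/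
def Kf (b : ℕ → ℤ) (L : ℕ) : ℤ := ∑ i ∈ range L, b i
/-- D[L] = p₁ + … + p_L (= Σ_j min(L, d_j)). -/
def Df (p : ℕ → ℤ) (L : ℕ) : ℤ := ∑ x ∈ range L, p (x + 1)
/-- Σ_{L=2}^{m+1} n_L · K[L], n_L = b_{L−1} − b_L. -/
def S1 (b : ℕ → ℤ) (m : ℕ) : ℤ := ∑ j ∈ range m, (b (j + 1) - b (j + 2)) * Kf b (j + 2)
/-- Σ_{L=2}^{m+1} n_L · D[L]. -/
def S2 (b p : ℕ → ℤ) (m : ℕ) : ℤ := ∑ j ∈ range m, (b (j + 1) - b (j + 2)) * Df p (j + 2)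
/-- level charge from −dim K + 14 K[β]: +13 b_i on a short level (i < β), −b_i on a long one. -/
def ind (b : ℕ → ℤ) (β : ℕ) (i : ℕ) : ℤ := if i < β then 13 * b i else - b i
/-- dim K = Σ_{i ≤ m} b_i (blocks of length ≤ m+1). -/
def dimK (b : ℕ → ℤ) (m : ℕ) : ℤ := ∑ i ∈ range (m + 1), b i
/-- K[β] written over the same range. -/
def Kβ (b : ℕ → ℤ) (m β : ℕ) : ℤ := ∑ i ∈ range (m + 1), (if i < β then b i else 0)

/-- The BLOCK FORM ΨA of memo §2 (τ = 1 + σ − R, σ = b 0, n₁ = b 0 − b 1). -/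
def blockForm (b p : ℕ → ℤ) (m β : ℕ) (R ℓ₂ : ℤ) : ℤ :=
  2 * (b 0 - b 1) * (1 + b 0 - R) + 2 * (S1 b m - S2 b p m) - dimK b m + 14 * Kβ b m β + β + 15 * ℓ₂
    - 4 * b 0 * (1 + b 0 - R) + 2

/-- The LEVEL FORM ΨB of memo §2. -/
def levelForm (b p : ℕ → ℤ) (m β : ℕ) (R ℓ₂ : ℤ) : ℤ :=
  9 * b 0 + 2 * (b 0 - b 1) + β + 2 + (R - (b 0 - b 1)) * (4 * b 0 - 2 * (b 0 - b 1))
    + ind b β 1 - 2 * b 1 * (p 1 + p 2) + 15 * ℓ₂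
    + ∑ j ∈ range m, (2 * b (j + 2) ^ 2 + ind b β (j + 2) - 2 * b (j + 2) * p (j + 3))

theorem Kf_one (b : ℕ → ℤ) : Kf b 1 = b 0 := by simp [Kf]
theorem Kf_succ2 (b : ℕ → ℤ) (j : ℕ) : Kf b (j + 2) = Kf b (j + 1) + b (j + 1) := by
  simp [Kf, sum_range_succ]
theorem Df_one (p : ℕ → ℤ) : Df p 1 = p 1 := by simp [Df]
theorem Df_succ2 (p : ℕ → ℤ) (j : ℕ) : Df p (j + 2) = Df p (j + 1) + p (j + 2) := by
  simp [Df, sum_range_succ]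
theorem S1_succ (b : ℕ → ℤ) (k : ℕ) : S1 b (k + 1) = S1 b k + (b (k + 1) - b (k + 2)) * Kf b (k + 2) := by
  simp [S1, sum_range_succ]
theorem S2_succ (b p : ℕ → ℤ) (k : ℕ) : S2 b p (k + 1) = S2 b p k + (b (k + 1) - b (k + 2)) * Df p (k + 2) := by
  simp [S2, sum_range_succ]

/-- Abel summation (I1), with the boundary term and the index shift made explicit:
Σ_{L=2}^{m+1} n_L K[L] + b_{m+1} K[m+1] = b₀b₁ + b₁² + Σ_{i=2}^{m+1} b_i² − b_{m+1}². -/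
theorem abel_K (b : ℕ → ℤ) (m : ℕ) :
    S1 b m + b (m + 1) * Kf b (m + 1) = b 0 * b 1 + b 1 ^ 2 + (∑ j ∈ range m, b (j + 2) ^ 2) - b (m + 1) ^ 2 := by
  induction m with
  | zero => simp [S1, Kf_one]; ring
  | succ k ih =>
      simp only [show k + 1 + 1 = k + 2 from rfl]
      rw [S1_succ, sum_range_succ, Kf_succ2]
      linear_combination ih

/-- Abel summation (I2): Σ_{L=2}^{m+1} n_L D[L] + b_{m+1} D[m+1] = b₁(p₁+p₂) + Σ_{i=2}^{m+1} b_i p_{i+1} − b_{m+1} p_{m+2}. -/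
theorem abel_D (b p : ℕ → ℤ) (m : ℕ) :
    S2 b p m + b (m + 1) * Df p (m + 1)
      = b 1 * (p 1 + p 2) + (∑ j ∈ range m, b (j + 2) * p (j + 3)) - b (m + 1) * p (m + 2) := by
  induction m with
  | zero => simp [S2, Df_one]; ring
  | succ k ih =>
      simp only [show k + 1 + 1 = k + 2 from rfl, show k + 1 + 2 = k + 3 from rfl]
      rw [S2_succ, sum_range_succ, Df_succ2]
      linear_combination ih

/-- (I3): −dim K + 14 K[β] = Σ_{i ≤ m} ind_i. -/
theorem ind_sum (b : ℕ → ℤ) (m β : ℕ) :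
    -dimK b m + 14 * Kβ b m β = ∑ i ∈ range (m + 1), ind b β i := by
  unfold dimK Kβ
  rw [mul_sum, ← sum_neg_distrib, ← sum_add_distrib]
  refine sum_congr rfl (fun i _ => ?_)
  unfold ind
  split_ifs <;> ring

/-- index shift for the level charges: Σ_{i ≤ m} ind_i + ind_{m+1} = ind_0 + ind_1 + Σ_{j<m} ind_{j+2}. -/
theorem ind_shift (b : ℕ → ℤ) (β m : ℕ) :
    (∑ i ∈ range (m + 1), ind b β i) + ind b β (m + 1) = ind b β 0 + ind b β 1 + ∑ j ∈ range m, ind b β (j + 2) := by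
  induction m with
  | zero => simp
  | succ k ih =>
      rw [sum_range_succ (fun i => ind b β i) (k + 1), sum_range_succ (fun j => ind b β (j + 2)) k]
      simp only [show k + 1 + 1 = k + 2 from rfl]
      linear_combination ih

/-- BLOCK FORM = LEVEL FORM (memo §2), for every profile whose blocks have length ≤ m+1 (b_{m+1} = 0) and β ≥ 1. -/
theorem blockForm_eq_levelForm (b p : ℕ → ℤ) (m β : ℕ) (R ℓ₂ : ℤ) (htop : b (m + 1) = 0) (hβ : 1 ≤ β) :
    blockForm b p m β R ℓ₂ = levelForm b p m β R ℓ₂ := by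
  have h1 := abel_K b m
  have h2 := abel_D b p m
  have h3 := ind_sum b m β
  have h4 := ind_shift b β m
  have h0 : ind b β 0 = 13 * b 0 := by unfold ind; rw [if_pos (by omega)]
  have h5 : ind b β (m + 1) = 0 := by unfold ind; split_ifs <;> simp [htop]
  rw [htop] at h1 h2
  unfold blockForm levelForm
  rw [sum_sub_distrib, sum_add_distrib]
  have e1 : ∑ j ∈ range m, 2 * b (j + 2) ^ 2 = 2 * ∑ j ∈ range m, b (j + 2) ^ 2 := by rw [mul_sum]
  have e2 : ∑ j ∈ range m, 2 * b (j + 2) * p (j + 3) = 2 * ∑ j ∈ range m, b (j + 2) * p (j + 3) := by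
    rw [mul_sum]; refine sum_congr rfl (fun j _ => by ring)
  rw [e1, e2]
  linear_combination 2 * h1 - 2 * h2 + h3 + h4 + h0 - h5

/-- one level i = j+2 ≥ 2 with its share 15·c_{i+1} of ℓ₂: at least b_i² if short (i < β), exactly 2b_i² − b_i if long. -/
theorem level_lower (b p c : ℕ → ℤ) (β j : ℕ) (hb : 0 ≤ b (j + 2)) (hp : 0 ≤ p (j + 3))
    (hpz : β < j + 3 → p (j + 3) = 0) (hc : 2 * c (j + 3) = p (j + 3) * (p (j + 3) - 1)) :
    (if j + 2 < β then b (j + 2) ^ 2 else 2 * b (j + 2) ^ 2 - b (j + 2))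
      ≤ 2 * b (j + 2) ^ 2 + ind b β (j + 2) - 2 * b (j + 2) * p (j + 3) + 15 * c (j + 3) := by
  unfold ind
  by_cases h : j + 2 < β
  · rw [if_pos h, if_pos h]
    have := level_short (b (j + 2)) (p (j + 3)) (c (j + 3)) hb hp hc
    linarith
  · rw [if_neg h, if_neg h]
    have hp0 : p (j + 3) = 0 := hpz (by omega)
    have hc0 : c (j + 3) = 0 := by rw [hp0] at hc; linarith
    rw [hp0, hc0]; linarith

theorem level_nonneg (b p c : ℕ → ℤ) (β j : ℕ) (hb : 0 ≤ b (j + 2)) (hp : 0 ≤ p (j + 3))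
    (hpz : β < j + 3 → p (j + 3) = 0) (hc : 2 * c (j + 3) = p (j + 3) * (p (j + 3) - 1)) :
    0 ≤ 2 * b (j + 2) ^ 2 + ind b β (j + 2) - 2 * b (j + 2) * p (j + 3) + 15 * c (j + 3) := by
  have h := level_lower b p c β j hb hp hpz hc
  have hl := level_long (b (j + 2)) hb
  by_cases hs : j + 2 < β
  · rw [if_pos hs] at h; nlinarith [sq_nonneg (b (j + 2))]
  · rw [if_neg hs] at h; linarith

/-- THEOREM E∞, level form: ΨB > 0 under the structural hypotheses of memo §1 (all imported from g14 + L7♯). -/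
theorem levelForm_pos (b p c : ℕ → ℤ) (m β : ℕ) (R ℓ₂ : ℤ)
    (hβ : 1 ≤ β) (hb0 : ∀ i, 0 ≤ b i) (hb10 : b 1 ≤ b 0) (htop : b (m + 1) = 0)
    (hp0 : ∀ x, 0 ≤ p x) (hpz : ∀ x, β < x → p x = 0) (hq : p 1 + p 2 ≤ (β : ℤ))
    (hc : ∀ x, 2 * c x = p x * (p x - 1))
    (hℓ : c 1 + c 2 + ∑ j ∈ range m, c (j + 3) ≤ ℓ₂)
    (hR : b 0 - b 1 ≤ R) (hcap : 2 ≤ β → b 1 ≤ b 2 + (p 1 + p 2) + 2) :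
    0 < levelForm b p m β R ℓ₂ := by
  have hσ : 0 ≤ b 0 := hb0 0
  have hb1 : 0 ≤ b 1 := hb0 1
  have hb2 : 0 ≤ b 2 := hb0 2
  have hc1 : 0 ≤ c 1 := c_nonneg (p 1) (c 1) (hp0 1) (hc 1)
  have hc2 : 0 ≤ c 2 := c_nonneg (p 2) (c 2) (hp0 2) (hc 2)
  have hbase : 0 ≤ (R - (b 0 - b 1)) * (4 * b 0 - 2 * (b 0 - b 1)) :=
    mul_nonneg (by linarith) (by linarith)
  -- the level sum with its ℓ₂-shares
  have hlev : ∀ j, 0 ≤ 2 * b (j + 2) ^ 2 + ind b β (j + 2) - 2 * b (j + 2) * p (j + 3) + 15 * c (j + 3) :=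
    fun j => level_nonneg b p c β j (hb0 _) (hp0 _) (hpz _) (hc _)
  have hsplit : (∑ j ∈ range m, (2 * b (j + 2) ^ 2 + ind b β (j + 2) - 2 * b (j + 2) * p (j + 3)))
        + 15 * ∑ j ∈ range m, c (j + 3)
      = ∑ j ∈ range m, (2 * b (j + 2) ^ 2 + ind b β (j + 2) - 2 * b (j + 2) * p (j + 3) + 15 * c (j + 3)) := by
    rw [mul_sum, ← sum_add_distrib]
  -- lower bound of the full level sum: 0 in general, and the level-2 bound when m ≥ 1
  have hsum0 : 0 ≤ ∑ j ∈ range m, (2 * b (j + 2) ^ 2 + ind b β (j + 2) - 2 * b (j + 2) * p (j + 3) + 15 * c (j + 3)) :=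
    sum_nonneg (fun j _ => hlev j)
  unfold levelForm
  rcases Nat.eq_zero_or_pos m with hm | hm
  · -- m = 0: every block has length 1, b 1 = 0
    subst hm
    have hb1z : b 1 = 0 := by simpa using htop
    have hi1 : ind b β 1 = 0 := by unfold ind; split_ifs <;> simp [hb1z]
    simp only [sum_range_zero, add_zero]
    simp only [sum_range_zero, add_zero] at hℓ
    rw [hi1, hb1z]
    rw [hb1z] at hbase
    nlinarith
  · -- m = k + 1: peel off level 2 (j = 0)
    obtain ⟨k, rfl⟩ : ∃ k, m = k + 1 := ⟨m - 1, by omega⟩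
    have hpeel : ∑ j ∈ range (k + 1), (2 * b (j + 2) ^ 2 + ind b β (j + 2) - 2 * b (j + 2) * p (j + 3) + 15 * c (j + 3))
        = (∑ j ∈ range k, (2 * b (j + 1 + 2) ^ 2 + ind b β (j + 1 + 2) - 2 * b (j + 1 + 2) * p (j + 1 + 3) + 15 * c (j + 1 + 3)))
          + (2 * b (0 + 2) ^ 2 + ind b β (0 + 2) - 2 * b (0 + 2) * p (0 + 3) + 15 * c (0 + 3)) := sum_range_succ' _ _
    have hrest : 0 ≤ ∑ j ∈ range k, (2 * b (j + 1 + 2) ^ 2 + ind b β (j + 1 + 2) - 2 * b (j + 1 + 2) * p (j + 1 + 3) + 15 * c (j + 1 + 3)) :=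
      sum_nonneg (fun j _ => hlev (j + 1))
    have h2 := level_lower b p c β 0 (hb0 _) (hp0 _) (hpz _) (hc _)
    simp only [show 0 + 2 = 2 from rfl, show 0 + 3 = 3 from rfl] at hpeel h2
    -- case analysis on β
    by_cases hβ1 : β = 1
    · subst hβ1
      have hi1 : ind b 1 1 = - b 1 := by unfold ind; rw [if_neg (by omega)]
      have hp2 : p 2 = 0 := hpz 2 (by omega)
      have hp1 : p 1 ≤ 1 := by push_cast at hq; linarith
      rw [if_neg (by omega)] at h2
      rw [hi1, hp2]
      nlinarith [mul_nonneg hb1 (show (0:ℤ) ≤ 1 - p 1 by linarith), hp0 1]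
    · have hβ2 : 2 ≤ β := by omega
      have hi1 : ind b β 1 = 13 * b 1 := by unfold ind; rw [if_pos (by omega)]
      have hcap' := hcap hβ2
      rw [hi1]
      by_cases hβ3 : 3 ≤ β
      · rw [if_pos (by omega)] at h2
        have hqq := q_sq_le (p 1) (p 2) (c 1 + c 2) (by have := hc 1; have := hc 2; linarith)
        have core := level_one_core (b 0) (b 0 - b 1) β (b 1) (b 2) (p 1 + p 2) (c 1 + c 2)
          hσ (by linarith) (by positivity) hb1 hb2 (by linarith) hqq hcap'
        nlinarith
      · have hβe : β = 2 := by omega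
        subst hβe
        rw [if_neg (by omega)] at h2
        push_cast at hq
        nlinarith [mul_nonneg hb1 (show (0:ℤ) ≤ 2 - (p 1 + p 2) by linarith)]

/-- THEOREM E∞, block form: ΨA > 0 (hence Ψ ≥ ΨA ≥ 1 and (QA♭)) under the same hypotheses. -/
theorem blockForm_pos (b p c : ℕ → ℤ) (m β : ℕ) (R ℓ₂ : ℤ)
    (hβ : 1 ≤ β) (hb0 : ∀ i, 0 ≤ b i) (hb10 : b 1 ≤ b 0) (htop : b (m + 1) = 0)
    (hp0 : ∀ x, 0 ≤ p x) (hpz : ∀ x, β < x → p x = 0) (hq : p 1 + p 2 ≤ (β : ℤ))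
    (hc : ∀ x, 2 * c x = p x * (p x - 1))
    (hℓ : c 1 + c 2 + ∑ j ∈ range m, c (j + 3) ≤ ℓ₂)
    (hR : b 0 - b 1 ≤ R) (hcap : 2 ≤ β → b 1 ≤ b 2 + (p 1 + p 2) + 2) :
    0 < blockForm b p m β R ℓ₂ := by
  rw [blockForm_eq_levelForm b p m β R ℓ₂ htop hβ]
  exact levelForm_pos b p c m β R ℓ₂ hβ hb0 hb10 htop hp0 hpz hq hc hℓ hR hcap

/-! ## Sanity anchors: the two numerical cells of the memo, now as instances of the `Finset` forms -/

/-- g14's β = 30 thin cell: blocks b = (36; 30, 16, 7, 3, 1), conjugate drops p = (13, 8, 5, 3, 1), R = 6, ℓ₂ = 119: ΨB = 2056 and ΨA = ΨB. -/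
theorem thin_cell_beta30 :
    levelForm (fun i => [36, 30, 16, 7, 3, 1].getD i 0) (fun x => [0, 13, 8, 5, 3, 1].getD x 0) 5 30 6 119 = 2056 ∧
    blockForm (fun i => [36, 30, 16, 7, 3, 1].getD i 0) (fun x => [0, 13, 8, 5, 3, 1].getD x 0) 5 30 6 119 = 2056 := by
  constructor
  · decide
  · decide

end HsemiregAlphabetUnipotent1.G15Sum
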